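import Literature.GroupTheory.CombinatorialGroupTheory.FreeGroupSubgroupSeparable
import Literature.GroupTheory.CombinatorialGroupTheory.FreeGroupResiduallyFinite
import Literature.GroupTheory.CombinatorialGroupTheory.FreeGroupNoncommutingPair
import Mathlib.GroupTheory.Schreier
import Mathlib.Data.ZMod.Basic
import HarnessLib

/-!
# Products of two cyclic subgroups of a free group are closed in the profinite topology

Topic `Literature/GroupTheory/CombinatorialGroupTheory`; theorems only.  **Theorem** (the cyclic case
of the double-coset separability of free groups: P. F. Stebe, *Conjugacy separability of certain free
products with amalgamation*, Trans. AMS 156 (1971), the lemma quoted as "Stebe's Theorem" in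
J. L. Dyer, *Separating conjugates in amalgamated free products and HNN extensions*, J. Austral. Math.
Soc. (A) 29 (1980), proof of Thm. 7 Case 3 p. 45, and proved there for free factors as Lemma 9 p. 47
in the form "separated by some `G → G/γ_c G`"; for arbitrary finitely generated subgroups:
G. A. Niblo, J. Pure Appl. Algebra 78 (1992)): *let `F` be a free group and `c, d, g ∈ F` with
`g ∉ ⟨c⟩⟨d⟩ = {cˢ dᵗ}`.  Then there is a normal subgroup `N` of finite index in `F` such that the image of
`g` in the finite group `F ⧸ N` does not lie in `⟨c̄⟩⟨d̄⟩`* — i.e. the product set of two cyclic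
subgroups is closed in the profinite topology of `F`.  Equivalently (`d ↦ v d v⁻¹`, `g ↦ g v⁻¹`) the
double cosets `⟨c⟩ v ⟨d⟩` are closed: `u ∉ ⟨c⟩ v ⟨d⟩` is witnessed in a finite quotient.  This is the
input "`u_{i+k} ∉ H v_k H` ⇒ `π_n(I : i)` has no solution" of the finite-quotient route to the conjugacy
separability of free products of free groups with cyclic amalgamation (Dyer 1980 Thm. 10), hence of
orientable surface groups (Stebe 1972 Thm. 3.3 — the tree's named fact
`SurfaceGroupConjugacySeparable`; nothing about that fact is claimed here).

* `FreeGroup.exists_normal_finiteIndex_forall_zpow_mul_zpow_ne` — the normal-subgroup form;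
* `FreeGroup.exists_normal_finiteIndex_not_mem_doubleCoset` — the double-coset form.

## Proof (elementary; exponent pinning instead of Dyer's nilpotent quotients)

Put `E = ⟨c, d⟩`.  If `g ∉ E`, M. Hall's theorem (`exists_finiteIndex_le_disjoint`) gives a
finite-index `L ⊇ E` missing `g`, and its normal core works.  If `c, d` commute, `E = {cˢdᵗ}` and the
same applies.  Otherwise `{c, d}` is a free basis of `E` (`lift_injective_of_mul_ne`), so `E` carries
the exponent sums `σ_c, σ_d : E → ℤ`; with `s = σ_c(g)`, `t = σ_d(g)` the element `w = (cˢdᵗ)⁻¹ g` is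
`≠ 1`, so some normal `N₀ ⊴ E` of finite index `M` misses it (free groups are residually finite,
`exists_finiteIndex_normal_notMem`); for `K = N₀ ∩ ker(σ_c mod M) ∩ ker(σ_d mod M)` a relation
`g = c^{s'} d^{t'} κ`, `κ ∈ K`, forces `s' ≡ s`, `t' ≡ t (mod M)` and then, as `c^M, d^M ∈ N₀`,
`w ∈ N₀` — a contradiction.  Finally `K` (transported to `F`) extends to a finite-index `L ≤ F` with
`L ∩ E ⊆ K` by M. Hall's theorem applied to a transversal of `E/K`, and the normal core of `L` is the
required `N`.

## References

* J. L. Dyer, *Separating conjugates in amalgamated free products and HNN extensions*, J. Austral.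
  Math. Soc. Ser. A 29 (1980) 35–51, Lemma 9 and proof of Thm. 7, Case 3. [Dyer1980]
* P. F. Stebe, *Conjugacy separability of certain free products with amalgamation*, Trans. Amer.
  Math. Soc. 156 (1971) 119–129.
* G. A. Niblo, *Separability properties of free groups and surface groups*, J. Pure Appl. Algebra 78
  (1992) 77–84.
-/

namespace Literature.GroupTheory.CombinatorialGroupTheory

namespace FreeGroupCyclicDoubleCosets

open Multiplicative

/-! ### Step 1: the rank-two model `F(a, b)`, `a = of 0`, `b = of 1` -/

/-- **Pinning lemma in the model.**  In `F(a, b)`: if `x ∉ {aˢ bᵗ}`, there is a normal subgroup `K`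
of finite index such that `aˢ bᵗ κ ≠ x` for all `s, t ∈ ℤ` and `κ ∈ K`.
[cite: Dyer1980, Lemma 9 p.47] -/
theorem model_exists_normal_finiteIndex (x : FreeGroup (Fin 2))
    (hx : ∀ s t : ℤ, FreeGroup.of 0 ^ s * FreeGroup.of 1 ^ t ≠ x) :
    ∃ K : Subgroup (FreeGroup (Fin 2)), K.Normal ∧ K.FiniteIndex ∧
      ∀ (s t : ℤ), ∀ κ ∈ K, FreeGroup.of 0 ^ s * FreeGroup.of 1 ^ t * κ ≠ x := by
  classical
  -- exponent sums
  let σ : Fin 2 → (FreeGroup (Fin 2) →* Multiplicative ℤ) := fun i =>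
    FreeGroup.lift fun l : Fin 2 => if l = i then ofAdd (1 : ℤ) else 1
  have hσ_same : ∀ i, σ i (FreeGroup.of i) = ofAdd 1 := fun i => by
    simp only [σ, FreeGroup.lift_apply_of, if_true]
  have hσ01 : σ 0 (FreeGroup.of 1) = 1 := by
    simp only [σ, FreeGroup.lift_apply_of]; decide
  have hσ10 : σ 1 (FreeGroup.of 0) = 1 := by
    simp only [σ, FreeGroup.lift_apply_of]; decide
  have hσ0 : ∀ s t : ℤ, σ 0 (FreeGroup.of 0 ^ s * FreeGroup.of 1 ^ t) = ofAdd s := by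
    intro s t
    rw [map_mul, map_zpow, map_zpow, hσ_same 0, hσ01, one_zpow, mul_one, ← ofAdd_zsmul,
      smul_eq_mul, mul_one]
  have hσ1 : ∀ s t : ℤ, σ 1 (FreeGroup.of 0 ^ s * FreeGroup.of 1 ^ t) = ofAdd t := by
    intro s t
    rw [map_mul, map_zpow, map_zpow, hσ_same 1, hσ10, one_zpow, one_mul, ← ofAdd_zsmul,
      smul_eq_mul, mul_one]
  -- the pinned exponents and the element `w`
  set s₀ : ℤ := toAdd (σ 0 x) with hs₀
  set t₀ : ℤ := toAdd (σ 1 x) with ht₀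
  set w : FreeGroup (Fin 2) := (FreeGroup.of 0 ^ s₀ * FreeGroup.of 1 ^ t₀)⁻¹ * x with hw
  have hw1 : w ≠ 1 := by
    intro h
    apply hx s₀ t₀
    rw [hw, inv_mul_eq_one] at h
    exact h
  -- residual finiteness: `N₀` normal of finite index missing `w`
  obtain ⟨N₀, hN₀n, hN₀f, hwN₀⟩ := exists_finiteIndex_normal_notMem w hw1
  haveI := hN₀n
  haveI := hN₀f
  set M : ℕ := N₀.index with hM
  haveI : NeZero M := ⟨Subgroup.FiniteIndex.index_ne_zero⟩
  -- reductions mod `M` of the exponent sums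
  let red : Multiplicative ℤ →* Multiplicative (ZMod M) := (Int.castAddHom (ZMod M)).toMultiplicative
  have hred : ∀ z : ℤ, red (ofAdd z) = ofAdd (z : ZMod M) := fun z => rfl
  let τ : Fin 2 → (FreeGroup (Fin 2) →* Multiplicative (ZMod M)) := fun i => red.comp (σ i)
  let K : Subgroup (FreeGroup (Fin 2)) := N₀ ⊓ (τ 0).ker ⊓ (τ 1).ker
  refine ⟨K, inferInstance, inferInstance, ?_⟩
  intro s t κ hκ hEq
  have hκN : κ ∈ N₀ := hκ.1.1
  have hκ0 : τ 0 κ = 1 := hκ.1.2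
  have hκ1 : τ 1 κ = 1 := hκ.2
  -- pin `s ≡ s₀`, `t ≡ t₀ (mod M)`
  have hs : ((s : ℤ) : ZMod M) = (s₀ : ZMod M) := by
    have h1 : τ 0 x = ofAdd (s : ZMod M) := by
      rw [← hEq, map_mul, hκ0, mul_one]
      change red (σ 0 _) = _
      rw [hσ0, hred]
    have h2 : τ 0 x = ofAdd (s₀ : ZMod M) := by
      change red (σ 0 x) = _
      rw [← hred, ofAdd_toAdd]
    simpa using congrArg toAdd (h1.symm.trans h2)
  have ht : ((t : ℤ) : ZMod M) = (t₀ : ZMod M) := by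
    have h1 : τ 1 x = ofAdd (t : ZMod M) := by
      rw [← hEq, map_mul, hκ1, mul_one]
      change red (σ 1 _) = _
      rw [hσ1, hred]
    have h2 : τ 1 x = ofAdd (t₀ : ZMod M) := by
      change red (σ 1 x) = _
      rw [← hred, ofAdd_toAdd]
    simpa using congrArg toAdd (h1.symm.trans h2)
  -- `M ∣ s₀ - s`, `M ∣ t₀ - t`
  have hds : (M : ℤ) ∣ s₀ - s := (ZMod.intCast_eq_intCast_iff_dvd_sub s s₀ M).1 hs
  have hdt : (M : ℤ) ∣ t₀ - t := (ZMod.intCast_eq_intCast_iff_dvd_sub t t₀ M).1 ht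
  -- `a^(s₀ - s), b^(t₀ - t) ∈ N₀`
  have hzpowN : ∀ (y : FreeGroup (Fin 2)) (e : ℤ), (M : ℤ) ∣ e → y ^ e ∈ N₀ := by
    intro y e he
    obtain ⟨q, rfl⟩ := he
    rw [zpow_mul, zpow_natCast]
    exact N₀.zpow_mem (N₀.pow_index_mem y) q
  have ha : FreeGroup.of 0 ^ (s₀ - s) ∈ N₀ := hzpowN _ _ hds
  have hb : FreeGroup.of 1 ^ (t₀ - t) ∈ N₀ := hzpowN _ _ hdt
  -- conclude `w ∈ N₀`, computing in the quotient `F ⧸ N₀`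
  apply hwN₀
  have e1 : (QuotientGroup.mk (FreeGroup.of 0 ^ s) : FreeGroup (Fin 2) ⧸ N₀) =
      QuotientGroup.mk (FreeGroup.of 0 ^ s₀) := by
    rw [QuotientGroup.eq, ← zpow_neg, ← zpow_add, neg_add_eq_sub]
    exact ha
  have e2 : (QuotientGroup.mk (FreeGroup.of 1 ^ t) : FreeGroup (Fin 2) ⧸ N₀) =
      QuotientGroup.mk (FreeGroup.of 1 ^ t₀) := by
    rw [QuotientGroup.eq, ← zpow_neg, ← zpow_add, neg_add_eq_sub]
    exact hb
  have e3 : (QuotientGroup.mk κ : FreeGroup (Fin 2) ⧸ N₀) = 1 :=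
    (QuotientGroup.eq_one_iff κ).2 hκN
  rw [← QuotientGroup.eq_one_iff, hw, ← hEq, QuotientGroup.mk_mul, QuotientGroup.mk_inv,
    QuotientGroup.mk_mul, QuotientGroup.mk_mul, QuotientGroup.mk_mul, e1, e2, e3, mul_one,
    inv_mul_cancel]

/-! ### Step 2: the case `g ∉ E` for a finitely generated `E ∋ c, d` (M. Hall) -/

variable {k : ℕ}

/-- If `c, d ∈ E`, `E` finitely generated and `g ∉ E`, then a normal subgroup of finite index keeps `g`
off `⟨c⟩⟨d⟩`: M. Hall's theorem gives a finite-index `L ⊇ E` missing `g`; take its normal core.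
[cite: LyndonSchupp2001, Ch. I Prop. 3.10] -/
theorem exists_normal_finiteIndex_of_not_mem (c d g : FreeGroup (Fin k))
    (E : Subgroup (FreeGroup (Fin k))) (hE : E.FG) (hc : c ∈ E) (hd : d ∈ E) (hg : g ∉ E) :
    ∃ N : Subgroup (FreeGroup (Fin k)), N.Normal ∧ N.FiniteIndex ∧
      ∀ (s t : ℤ), ∀ n ∈ N, c ^ s * d ^ t * n ≠ g := by
  obtain ⟨L, hLf, hEL, hgL⟩ := exists_finiteIndex_le_not_mem E hE hg
  haveI := hLf
  refine ⟨L.normalCore, inferInstance, inferInstance, ?_⟩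
  intro s t n hn hEq
  apply hgL
  rw [← hEq]
  exact L.mul_mem (hEL (E.mul_mem (E.zpow_mem hc s) (E.zpow_mem hd t))) (L.normalCore_le hn)

/-! ### Step 3: commuting `c, d` -/

/-- If `c` and `d` commute, every element of `⟨c, d⟩` is `cˢ dᵗ`. [folklore] -/
private theorem exists_eq_zpow_mul_zpow_of_mem_closure {G : Type*} [Group G] {c d : G}
    (hcd : c * d = d * c) {x : G} (hx : x ∈ Subgroup.closure ({c, d} : Set G)) :
    ∃ s t : ℤ, x = c ^ s * d ^ t := by
  have hcomm : Commute c d := hcd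
  induction hx using Subgroup.closure_induction with
  | mem y hy =>
    rcases hy with rfl | hy
    · exact ⟨1, 0, by simp⟩
    · rw [Set.mem_singleton_iff] at hy
      subst hy
      exact ⟨0, 1, by simp⟩
  | one => exact ⟨0, 0, by simp⟩
  | mul y z _ _ hy hz =>
    obtain ⟨s, t, rfl⟩ := hy
    obtain ⟨s', t', rfl⟩ := hz
    refine ⟨s + s', t + t', ?_⟩
    rw [zpow_add, zpow_add, mul_assoc, mul_assoc, ← mul_assoc (d ^ t),
      ((hcomm.zpow_zpow s' t).symm).eq, mul_assoc]
  | inv y _ hy =>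
    obtain ⟨s, t, rfl⟩ := hy
    refine ⟨-s, -t, ?_⟩
    rw [mul_inv_rev, zpow_neg, zpow_neg, (hcomm.zpow_zpow s t).inv_inv.symm.eq]

/-- The commuting case: if `c d = d c` and `g ∉ {cˢ dᵗ}` then `g ∉ ⟨c, d⟩`, and Step 2 applies.
[cite: Dyer1980, Lemma 9 p.47] -/
theorem exists_normal_finiteIndex_of_commute (c d g : FreeGroup (Fin k)) (hcd : c * d = d * c)
    (hg : ∀ s t : ℤ, c ^ s * d ^ t ≠ g) :
    ∃ N : Subgroup (FreeGroup (Fin k)), N.Normal ∧ N.FiniteIndex ∧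
      ∀ (s t : ℤ), ∀ n ∈ N, c ^ s * d ^ t * n ≠ g := by
  classical
  let E : Subgroup (FreeGroup (Fin k)) := Subgroup.closure ({c, d} : Set (FreeGroup (Fin k)))
  have hE : E.FG := (Subgroup.fg_iff E).2 ⟨{c, d}, rfl, Set.toFinite _⟩
  have hc : c ∈ E := Subgroup.subset_closure (by simp)
  have hd : d ∈ E := Subgroup.subset_closure (by simp)
  have hgE : g ∉ E := by
    intro h
    obtain ⟨s, t, rfl⟩ := exists_eq_zpow_mul_zpow_of_mem_closure hcd h
    exact hg s t rfl
  exact exists_normal_finiteIndex_of_not_mem c d g E hE hc hd hgE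

/-! ### Step 4: non-commuting `c, d`: transport from the model along the free basis `{c, d}` of `⟨c, d⟩` -/

/-- The non-commuting case: `{c, d}` is a free basis of `E = ⟨c, d⟩` (`lift_injective_of_mul_ne`);
the model's `K` transported to `E` extends, by M. Hall's theorem applied to a transversal of `E/K`,
to a finite-index `L ≤ F` with `L ∩ E ⊆ K`, whose normal core works. [cite: Dyer1980, Lemma 9 p.47] -/
theorem exists_normal_finiteIndex_of_mul_ne (c d g : FreeGroup (Fin k)) (hcd : c * d ≠ d * c)
    (hg : ∀ s t : ℤ, c ^ s * d ^ t ≠ g) :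
    ∃ N : Subgroup (FreeGroup (Fin k)), N.Normal ∧ N.FiniteIndex ∧
      ∀ (s t : ℤ), ∀ n ∈ N, c ^ s * d ^ t * n ≠ g := by
  classical
  -- the free basis `{c, d}` of `E = ⟨c, d⟩`
  let u : Fin 2 → FreeGroup (Fin k) := ![c, d]
  have hu0 : u 0 = c := rfl
  have hu1 : u 1 = d := rfl
  let φ : FreeGroup (Fin 2) →* FreeGroup (Fin k) := FreeGroup.lift u
  have hφ0 : φ (FreeGroup.of 0) = c := by rw [FreeGroup.lift_apply_of]; rfl
  have hφ1 : φ (FreeGroup.of 1) = d := by rw [FreeGroup.lift_apply_of]; rfl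
  have hφinj : Function.Injective φ := lift_injective_of_mul_ne u (by rw [hu0, hu1]; exact hcd)
  have hφst : ∀ s t : ℤ, φ (FreeGroup.of 0 ^ s * FreeGroup.of 1 ^ t) = c ^ s * d ^ t := by
    intro s t; rw [map_mul, map_zpow, map_zpow, hφ0, hφ1]
  let E : Subgroup (FreeGroup (Fin k)) := φ.range
  have hEcl : E = Subgroup.closure (Set.range u) := FreeGroup.range_lift_eq_closure
  have hE : E.FG := (Subgroup.fg_iff E).2 ⟨Set.range u, hEcl.symm, Set.finite_range u⟩
  have hc : c ∈ E := ⟨FreeGroup.of 0, hφ0⟩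
  have hd : d ∈ E := ⟨FreeGroup.of 1, hφ1⟩
  by_cases hgE : g ∈ E
  swap
  · exact exists_normal_finiteIndex_of_not_mem c d g E hE hc hd hgE
  -- `g = φ x` with `x ∉ {aˢ bᵗ}`
  obtain ⟨x, rfl⟩ := hgE
  have hx : ∀ s t : ℤ, FreeGroup.of 0 ^ s * FreeGroup.of 1 ^ t ≠ x := by
    intro s t h
    exact hg s t (by rw [← hφst, h])
  obtain ⟨K, hKn, hKf, hK⟩ := model_exists_normal_finiteIndex x hx
  haveI := hKn
  haveI := hKf
  -- `H = φ(K)` is finitely generated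
  let H : Subgroup (FreeGroup (Fin k)) := K.map φ
  have hKfg : K.FG := by
    haveI : Group.FG K := inferInstance
    exact (Group.fg_iff_subgroup_fg K).1 inferInstance
  have hH : H.FG := by
    obtain ⟨S, hS, hSfin⟩ := (Subgroup.fg_iff K).1 hKfg
    exact (Subgroup.fg_iff H).2 ⟨φ '' S, by rw [← MonoidHom.map_closure, hS], hSfin.image _⟩
  -- a transversal of `K` in `F(a, b)` and its image off `K`
  let T : Set (FreeGroup (Fin 2)) := Set.range fun q : FreeGroup (Fin 2) ⧸ K => q.out
  have hTfin : T.Finite := Set.finite_range _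
  let A : Set (FreeGroup (Fin k)) := φ '' (T \ (K : Set (FreeGroup (Fin 2))))
  have hAfin : A.Finite := (hTfin.subset Set.sdiff_subset).image _
  have hHA : Disjoint (H : Set (FreeGroup (Fin k))) A := by
    rw [Set.disjoint_left]
    rintro _ ⟨κ, hκ, rfl⟩ ⟨t₀, ⟨_, ht₀K⟩, ht₀⟩
    exact ht₀K (by rwa [← hφinj ht₀] at hκ)
  obtain ⟨L, hLf, hHL, hLA⟩ := exists_finiteIndex_le_disjoint H hH A hAfin hHA
  haveI := hLf
  refine ⟨L.normalCore, inferInstance, inferInstance, ?_⟩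
  intro s t n hn hEq
  -- `n = φ y` with `y = (aˢ bᵗ)⁻¹ x`
  set y : FreeGroup (Fin 2) := (FreeGroup.of 0 ^ s * FreeGroup.of 1 ^ t)⁻¹ * x with hy
  have hny : n = φ y := by
    rw [hy, map_mul, map_inv, hφst, eq_inv_mul_iff_mul_eq, hEq]
  have hnL : n ∈ L := L.normalCore_le hn
  -- the representative of the coset `y K`
  obtain ⟨κ, hκ⟩ := QuotientGroup.mk_out_eq_mul K y
  have ht₀T : (QuotientGroup.mk y : FreeGroup (Fin 2) ⧸ K).out ∈ T := ⟨_, rfl⟩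
  have hφt₀L : φ (QuotientGroup.mk y : FreeGroup (Fin 2) ⧸ K).out ∈ L := by
    rw [hκ, map_mul, ← hny]
    exact L.mul_mem hnL (hHL ⟨κ, κ.2, rfl⟩)
  -- hence the representative lies in `K`, so `y ∈ K`
  have ht₀K : (QuotientGroup.mk y : FreeGroup (Fin 2) ⧸ K).out ∈ K := by
    by_contra h
    exact Set.disjoint_left.1 hLA hφt₀L ⟨_, ⟨ht₀T, h⟩, rfl⟩
  have hyK : y ∈ K := by
    have : y = (QuotientGroup.mk y : FreeGroup (Fin 2) ⧸ K).out * (κ : FreeGroup (Fin 2))⁻¹ := by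
      rw [hκ, mul_inv_cancel_right]
    rw [this]
    exact K.mul_mem ht₀K (K.inv_mem κ.2)
  -- contradiction with the model
  exact hK s t y hyK (by rw [hy, mul_inv_cancel_left])

end FreeGroupCyclicDoubleCosets

open FreeGroupCyclicDoubleCosets

/-! ### The theorems -/

/-- **Products of two cyclic subgroups of a free group are profinitely closed** (Stebe 1971; Dyer 1980
Lemma 9 in finite form; Niblo 1992 for arbitrary finitely generated subgroups): in `F = F(Fin k)`, if
`g ≠ cˢ dᵗ` for all `s, t ∈ ℤ`, then there is a normal subgroup `N` of finite index with
`cˢ dᵗ n ≠ g` for all `s, t ∈ ℤ`, `n ∈ N`. [cite: Dyer1980, Lemma 9 p.47] -/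
theorem _root_.FreeGroup.exists_normal_finiteIndex_forall_zpow_mul_zpow_ne {k : ℕ}
    (c d g : FreeGroup (Fin k)) (hg : ∀ s t : ℤ, c ^ s * d ^ t ≠ g) :
    ∃ N : Subgroup (FreeGroup (Fin k)), N.Normal ∧ N.FiniteIndex ∧
      ∀ (s t : ℤ), ∀ n ∈ N, c ^ s * d ^ t * n ≠ g := by
  by_cases hcd : c * d = d * c
  · exact exists_normal_finiteIndex_of_commute c d g hcd hg
  · exact exists_normal_finiteIndex_of_mul_ne c d g hcd hg

/-- **Quotient form**: under the same hypothesis, in some finite quotient `F ⧸ N` the image of `g`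
is not of the form `c̄ˢ d̄ᵗ`. [cite: Dyer1980, Lemma 9 p.47] -/
theorem _root_.FreeGroup.exists_normal_finiteIndex_mk_zpow_mul_zpow_ne {k : ℕ}
    (c d g : FreeGroup (Fin k)) (hg : ∀ s t : ℤ, c ^ s * d ^ t ≠ g) :
    ∃ (N : Subgroup (FreeGroup (Fin k))) (_ : N.Normal) (_ : N.FiniteIndex),
      ∀ s t : ℤ, (QuotientGroup.mk c : FreeGroup (Fin k) ⧸ N) ^ s * (QuotientGroup.mk d) ^ t ≠
        QuotientGroup.mk g := by
  obtain ⟨N, hNn, hNf, hN⟩ := FreeGroup.exists_normal_finiteIndex_forall_zpow_mul_zpow_ne c d g hg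
  refine ⟨N, hNn, hNf, fun s t h => ?_⟩
  rw [← QuotientGroup.mk_zpow, ← QuotientGroup.mk_zpow, ← QuotientGroup.mk_mul, QuotientGroup.eq]
    at h
  exact hN s t _ h (by rw [mul_inv_cancel_left])

/-- **Double-coset form** (Dyer's "Stebe's Theorem", proof of Thm. 7 Case 3; Lemma 9): in `F = F(Fin k)`,
if `u ∉ ⟨c⟩ v ⟨d⟩`, i.e. `cˢ v dᵗ ≠ u` for all `s, t ∈ ℤ`, then in some finite quotient `F ⧸ N` the
image of `u` does not lie in `⟨c̄⟩ v̄ ⟨d̄⟩`. [cite: Dyer1980, Lemma 9 p.47] -/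
theorem _root_.FreeGroup.exists_normal_finiteIndex_not_mem_doubleCoset {k : ℕ}
    (c d u v : FreeGroup (Fin k)) (hu : ∀ s t : ℤ, c ^ s * v * d ^ t ≠ u) :
    ∃ (N : Subgroup (FreeGroup (Fin k))) (_ : N.Normal) (_ : N.FiniteIndex),
      ∀ s t : ℤ, (QuotientGroup.mk c : FreeGroup (Fin k) ⧸ N) ^ s * QuotientGroup.mk v *
        (QuotientGroup.mk d) ^ t ≠ QuotientGroup.mk u := by
  -- `cˢ (v d v⁻¹)ᵗ = cˢ v dᵗ v⁻¹`, so apply the theorem to `c`, `v d v⁻¹`, `u v⁻¹`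
  have hg : ∀ s t : ℤ, c ^ s * (v * d * v⁻¹) ^ t ≠ u * v⁻¹ := by
    intro s t h
    apply hu s t
    rw [conj_zpow, ← mul_assoc, ← mul_assoc] at h
    exact mul_right_cancel h
  obtain ⟨N, hNn, hNf, hN⟩ :=
    FreeGroup.exists_normal_finiteIndex_mk_zpow_mul_zpow_ne c (v * d * v⁻¹) (u * v⁻¹) hg
  refine ⟨N, hNn, hNf, fun s t h => hN s t ?_⟩
  calc (QuotientGroup.mk c : FreeGroup (Fin k) ⧸ N) ^ s * QuotientGroup.mk (v * d * v⁻¹) ^ t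
      = (QuotientGroup.mk c) ^ s * QuotientGroup.mk v * (QuotientGroup.mk d) ^ t *
          (QuotientGroup.mk v)⁻¹ := by
        rw [QuotientGroup.mk_mul, QuotientGroup.mk_mul, QuotientGroup.mk_inv, conj_zpow, ← mul_assoc,
          ← mul_assoc]
    _ = QuotientGroup.mk u * (QuotientGroup.mk v)⁻¹ := by rw [h]
    _ = QuotientGroup.mk (u * v⁻¹) := by rw [QuotientGroup.mk_mul, QuotientGroup.mk_inv]

/-- The same for a free group on any FINITE alphabet `ι` (transport along `F(ι) ≃* F(Fin k)`).
[cite: Dyer1980, Lemma 9 p.47] -/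
theorem _root_.FreeGroup.exists_normal_finiteIndex_forall_zpow_mul_zpow_ne_of_finite {ι : Type*}
    [Finite ι] (c d g : FreeGroup ι) (hg : ∀ s t : ℤ, c ^ s * d ^ t ≠ g) :
    ∃ N : Subgroup (FreeGroup ι), N.Normal ∧ N.FiniteIndex ∧
      ∀ (s t : ℤ), ∀ n ∈ N, c ^ s * d ^ t * n ≠ g := by
  obtain ⟨k, ⟨e⟩⟩ := Finite.exists_equiv_fin ι
  let θ : FreeGroup ι ≃* FreeGroup (Fin k) := FreeGroup.freeGroupCongr e
  have hg' : ∀ s t : ℤ, θ c ^ s * θ d ^ t ≠ θ g := by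
    intro s t h
    apply hg s t
    apply θ.injective
    rw [map_mul, map_zpow, map_zpow, h]
  obtain ⟨N, hNn, hNf, hN⟩ :=
    FreeGroup.exists_normal_finiteIndex_forall_zpow_mul_zpow_ne (θ c) (θ d) (θ g) hg'
  haveI := hNn
  haveI := hNf
  refine ⟨N.comap θ.toMonoidHom, inferInstance, ?_, ?_⟩
  · exact ⟨by
      rw [Subgroup.index_comap_of_surjective N (f := θ.toMonoidHom) θ.surjective]
      exact Subgroup.FiniteIndex.index_ne_zero⟩
  · intro s t n hn h
    apply hN s t (θ n) hn
    rw [← map_zpow, ← map_zpow, ← map_mul, ← map_mul, h]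

end Literature.GroupTheory.CombinatorialGroupTheory
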